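import Summits.BirchSwinnertonDyer.BirchSwinnertonDyer.Theorems.PrintCf2RubinValueTwoRowOneLocalLaw
import Summits.BirchSwinnertonDyer.BirchSwinnertonDyer.Theorems.PrintCf2RubinValueTwoJLKDescentRowOneCokernel
import Summits.BirchSwinnertonDyer.BirchSwinnertonDyer.Theorems.PrintCf2RubinValueTwoLinePinClassJunctionXRegular
import Summits.BirchSwinnertonDyer.BirchSwinnertonDyer.Theorems.PrintCf2SplitBadTwoDoublyAdaptedPair
import HarnessLib

/-!
# (α3) ROW 1 — the displayed local hypothesis `hplaces` of `JLKDescent.classGroupRow_hfcoker` ON THE `D = −7` FRAME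

Cell `bsd-print-cf2`, width seat `bsd-line-cf2-p1-w3` g20, lane (α3) ROW 1 of `stub_classGroupHalf` (DECIDING research child
stmt-BirchSwinnertonDyer-24721 → class line 23300); `--supports` it `--as helper`, Theses-free.

`JLKDescent.classGroupRow_hfcoker` (cf2c-w8 g9, `…JLKDescentRowOneCokernel.lean`) bounds the cokernel of the class-group row from ONE
displayed local datum `hplaces`: at every `v ∈ supp(p𝔣)`, EITHER `p^e` kills `H²(Λ_n^{(v)}, (μ_{p^k} ⊗ θ′)^{N_S}|)` for all `n, k`, OR both
pins decompose at `v` — `η_i = res_v(δ_i)·h_i`, `h_i ∈ Gal(K̄/K̃_∞)` — and `p^e·(conj_{δ_i} c − u_i·c) = 0` for all `n, k`.  THIS FILE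
DISCHARGES `hplaces` on the cell's DA7 frame (`K = ℚ(√−7)`, `2 = v v̄`, `(κ₁, κ₂)` doubly adapted with generators `γ₁ ∈ I_v`, `γ₂ ∈ I_v̄`,
`θ` quadratic, pins `(γ₁⁻¹, γ₂⁻¹)`, `θ′ = unitChar θ`, `p = 2`, `e = 2`):

* §1 (generic `p`) the DECOMPOSITION of a pin at a place: `exists_decomposition_of_mem_decomp` (`τ ∈ D_w` with `κ_i τ = κ_i γ` ⟹
  `γ⁻¹ = res_w δ · h`, `h ∈ pairKer`), `exists_mem_decomp_apply_eq_and` (correct a `τ ∈ D_w` matching one character by an inertia element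
  to match both), `mem_localLayer_of_apply_mem` / `isOpen_localLayer` (the local layer groups `Λ_n^{(w)} = φ_w⁻¹ V̄_n`);
* §2 (DA7) `exists_decomposition_inv_left_v`, `exists_decomposition_inv_right_v`, `exists_decomposition_inv_left_vbar`,
  `exists_decomposition_inv_right_vbar` — the four decompositions `γ_i⁻¹ = res(δ)·h` at `v` and at `v̄` (the non-obvious two by
  `LinePin.exists_mem_decomp_vbar_apply_eq_of_discr` «`v̄` is undecomposed in the `v`-line» and the `ℤ₂`-saturation of the inertia
  image `DoublyAdaptedPair.exists_mem_inertia_apply_eq_of_isUnramifiedOutside'`);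
* §3 ★ **`hplaces_of_discr_eq_neg_seven`** — the binder `hplaces` VERBATIM with `p := 2`, `θ′ := unitChar θ`, `(η₁, η₂) := (γ₁⁻¹, γ₂⁻¹)`,
  `e := 2`: at a place above `2` (`= v` or `v̄`) the second disjunct by §2 and the uniform law
  `RowOneLocalLaw.four_smul_conjMap_sub_eq_zero_of_apply_eq_{one,neg_one}` (this seat, via the local class field theory input
  `LocalInvariantMapSubgroupInjective`); at a tame place the first disjunct by `RowOneLocalLaw.four_smul_eq_zero_of_exists_apply_eq_neg_one`
  with the displayed inertia element of `hram` (the currency of `ClassGroupRow.two_nsmul_eq_zero_of_forall_toDual_iota_eq_zero`).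

Displayed (not discharged here): `hμ : N_S ≤ ker(μ_{2^k} ⊗ θ′)` (frame fact of the carriers), `hram` (exact tame conductor, as in ROW 1's
kernel bound), `h2 : every place of supp(2𝔣) above 2 is v or v̄` (DA7 count).  THEOREMS ONLY; no summit statement is proved by this seat;
BSD is not proved by any of this.

References: J. Johnson-Leung, G. Kings (2011) §5.4 Lemma 5.8 [JohnsonLeungKings2011]; J. Neukirch, *Algebraic Number Theory* II (9.6)
[NeukirchANT1999]; L. Washington, *Cyclotomic Fields* §13.1 [Washington1997].
-/

noncomputable section

set_option linter.dupNamespace false -- D-0017: single-problem summit, `…BirchSwinnertonDyer.BirchSwinnertonDyer…` repeats a namespace by design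
set_option autoImplicit false

open scoped NumberField
open CategoryTheory Function Field IsDedekindDomain NumberField
open Literature.NumberTheory.GaloisRepresentations
open Literature.NumberTheory.GaloisRepresentations.DiscreteGaloisModule
open Literature.NumberTheory.EllipticCurves
open Literature.NumberTheory.EllipticCurves.GreenbergSelmer (decomp inertia mem_decomp_iff inertia_le_decomp)
open Literature.NumberTheory.GaloisCohomology.ShaLayer (locHom)
open Literature.NumberTheory.ComplexMultiplication.EllipticUnits.JohnsonLeungKings2011 (muTwist pairLayerSubgroup suppPF
  isOpen_pairLayerSubgroup pairKer_le_pairLayerSubgroup)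
open Literature.NumberTheory.EllipticCurves.KellerYin2024 (unitChar)
open Literature.NumberTheory.ComplexMultiplication.EllipticUnits.JohnsonLeungKings2011.ClassGroupRow (unitChar_eq_one_or_eq_neg_one_of_sq)
open _root_.TopRep _root_.ContinuousCohomology

namespace Summit.BirchSwinnertonDyer.BirchSwinnertonDyer.Theorems.PrintCf2.JLKDescent

attribute [local instance] absoluteGaloisGroup_compactSpace compactSpace_of_isClosed_subgroup

/-! ## §1 Decomposition of a pin at a place; the local layer groups -/

section Generic

variable {K : Type} [Field K] [NumberField K] {p : ℕ} [Fact p.Prime] (κ₁ κ₂ : ZpExtension K p)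

/-- **Decomposition of a pin.**  If `τ ∈ D_w` (the chosen decomposition group, `= range res_w`) has `κ₁ τ = κ₁ γ` and `κ₂ τ = κ₂ γ`, then
`γ⁻¹ = res_w(δ) · h` with `h = τ γ⁻¹ ∈ Gal(K̄/K̃_∞) = pairKer κ₁ κ₂` and `res_w δ = τ⁻¹`. [cite: NeukirchANT1999, Ch. II §9 Prop. (9.6)] -/
theorem exists_decomposition_of_mem_decomp {w : HeightOneSpectrum (𝓞 K)} {γ τ : absoluteGaloisGroup K} (hτ : τ ∈ decomp w)
    (h1 : κ₁ τ = κ₁ γ) (h2 : κ₂ τ = κ₂ γ) :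
    ∃ (δ : absoluteGaloisGroup (w.adicCompletion K)) (h : absoluteGaloisGroup K),
      h ∈ ZpExtension.pairKer κ₁ κ₂ ∧ γ⁻¹ = absGaloisRestrict K (w.adicCompletion K) δ * h := by
  obtain ⟨δ, hδ⟩ := (mem_decomp_iff w τ⁻¹).mp (inv_mem hτ)
  refine ⟨δ, τ * γ⁻¹, ?_, ?_⟩
  · rw [ZpExtension.mem_pairKer_iff, map_mul, map_mul, map_inv, map_inv, h1, h2, mul_inv_cancel, mul_inv_cancel]
    exact ⟨rfl, rfl⟩
  · rw [hδ, ← mul_assoc, inv_mul_cancel, one_mul]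

/-- **Correcting a decomposition element by inertia.**  If `τ ∈ D_w` matches `γ` under `κb`, `κa` maps the inertia group `I_w` ONTO `ℤ_p`
(`hsurj`) and `κb` is trivial on `I_w` (`hker`), then some `τ′ ∈ D_w` matches `γ` under BOTH `κa` and `κb` (`τ′ = τ·ι`, `ι ∈ I_w`).
[cite: Washington1997, §13.1] [cite: NeukirchANT1999, Ch. I §9 Def. (9.5)] -/
theorem exists_mem_decomp_apply_eq_and (κa κb : ZpExtension K p) {w : HeightOneSpectrum (𝓞 K)} {γ τ : absoluteGaloisGroup K}
    (hτ : τ ∈ decomp w) (hb : κb τ = κb γ)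
    (hsurj : ∀ x : ℤ_[p], ∃ ι ∈ inertia w, κa ι = Multiplicative.ofAdd x) (hker : inertia w ≤ κb.kerSubgroup) :
    ∃ τ' ∈ decomp w, κa τ' = κa γ ∧ κb τ' = κb γ := by
  obtain ⟨ι, hι, hκι⟩ := hsurj (Multiplicative.toAdd (κa γ) - Multiplicative.toAdd (κa τ))
  refine ⟨τ * ι, mul_mem hτ (inertia_le_decomp w hι), ?_, ?_⟩
  · rw [map_mul, hκι]
    apply Multiplicative.toAdd.injective
    rw [toAdd_mul, toAdd_ofAdd]
    ring
  · rw [map_mul, hb, ZpExtension.mem_kerSubgroup.mp (hker hι), mul_one]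

/-- `σ ∈ Γ_{K_w}` with `res_w σ ∈ V_n` lies in the local layer group `Λ_n^{(w)} = φ_w⁻¹(V̄_n)`. [cite: JohnsonLeungKings2011, §5.4 Lemma 5.8 (proof)] -/
theorem mem_localLayer_of_apply_mem (𝔖 : Set (HeightOneSpectrum (𝓞 K))) (w : HeightOneSpectrum (𝓞 K)) (n : ℕ)
    {σ : absoluteGaloisGroup (w.adicCompletion K)} (hσ : absGaloisRestrict K (w.adicCompletion K) σ ∈ pairLayerSubgroup κ₁ κ₂ n) :
    σ ∈ ((pairLayerSubgroup κ₁ κ₂ n).map (toUnramifiedQuot K 𝔖)).comap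
      (locHom (S := 𝔖) w : absoluteGaloisGroup (w.adicCompletion K) →* GaloisGroupUnramifiedOutside K 𝔖) :=
  Subgroup.mem_comap.mpr (Subgroup.mem_map.mpr ⟨_, hσ, rfl⟩)

/-- The local layer group `Λ_n^{(w)} = φ_w⁻¹(V̄_n)` is open. [cite: JohnsonLeungKings2011, §5.4 Lemma 5.8 (proof)] -/
theorem isOpen_localLayer (𝔖 : Set (HeightOneSpectrum (𝓞 K))) (w : HeightOneSpectrum (𝓞 K)) (n : ℕ) :
    IsOpen ((((pairLayerSubgroup κ₁ κ₂ n).map (toUnramifiedQuot K 𝔖)).comap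
      (locHom (S := 𝔖) w : absoluteGaloisGroup (w.adicCompletion K) →* GaloisGroupUnramifiedOutside K 𝔖) :
        Subgroup (absoluteGaloisGroup (w.adicCompletion K))) : Set (absoluteGaloisGroup (w.adicCompletion K))) :=
  (Literature.NumberTheory.GaloisCohomology.ShaLayer.isOpen_map_toUnramifiedQuot 𝔖 (pairLayerSubgroup κ₁ κ₂ n)
    (isOpen_pairLayerSubgroup κ₁ κ₂ n)).preimage (locHom (S := 𝔖) w).continuous

end Generic

/-! ## §2 The four decompositions on the `D = −7` frame -/

section DA7

variable {K : Type} [Field K] [NumberField K] (hK : IsImaginaryQuadratic K) (h2K : ¬ 2 ∣ NumberField.classNumber K)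
  (hdisc : NumberField.discr K = -7) {v vbar : HeightOneSpectrum (𝓞 K)} (hv : ((2 : ℕ) : 𝓞 K) ∈ v.asIdeal)
  (hvbar : ((2 : ℕ) : 𝓞 K) ∈ vbar.asIdeal) (hne : vbar ≠ v) {κ₁ κ₂ : ZpExtension K 2} {γ₁ γ₂ : absoluteGaloisGroup K}
  (hpair : ZpExtension.IsTopGeneratorPair κ₁ κ₂ γ₁ γ₂) (hκ₂ : κ₂.IsUnramifiedOutside vbar) (hκ₁ : κ₁.IsUnramifiedOutside v)
  (hγ₁ : γ₁ ∈ inertia v) (hγ₂ : γ₂ ∈ inertia vbar)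

include hγ₁ in
/-- At `v`: `γ₁⁻¹ = res_v(δ)·h` (`γ₁ ∈ I_v ≤ D_v`, `h = 1`). [cite: NeukirchANT1999, Ch. II §9 Prop. (9.6)] -/
theorem exists_decomposition_inv_left_v :
    ∃ (δ : absoluteGaloisGroup (v.adicCompletion K)) (h : absoluteGaloisGroup K),
      h ∈ ZpExtension.pairKer κ₁ κ₂ ∧ γ₁⁻¹ = absGaloisRestrict K (v.adicCompletion K) δ * h :=
  exists_decomposition_of_mem_decomp κ₁ κ₂ (inertia_le_decomp v hγ₁) rfl rfl

include hγ₂ in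
/-- At `v̄`: `γ₂⁻¹ = res_v̄(δ)·h` (`γ₂ ∈ I_v̄ ≤ D_v̄`, `h = 1`). [cite: NeukirchANT1999, Ch. II §9 Prop. (9.6)] -/
theorem exists_decomposition_inv_right_vbar :
    ∃ (δ : absoluteGaloisGroup (vbar.adicCompletion K)) (h : absoluteGaloisGroup K),
      h ∈ ZpExtension.pairKer κ₁ κ₂ ∧ γ₂⁻¹ = absGaloisRestrict K (vbar.adicCompletion K) δ * h :=
  exists_decomposition_of_mem_decomp κ₁ κ₂ (inertia_le_decomp vbar hγ₂) rfl rfl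

include hK h2K hdisc hv hvbar hne hpair hκ₂ hκ₁ in
/-- **At `v`: `γ₂⁻¹ = res_v(δ)·h` with `h ∈ Gal(K̄/K̃_∞)`** — `v` is undecomposed in the `κ₂`-line (`LinePin.exists_mem_decomp_vbar_apply_eq_of_discr`
with the rôles of `v, v̄` exchanged: some `τ ∈ D_v` has `κ₂ τ = κ₂ γ₂`), corrected by an element of `I_v` (onto `ℤ₂` under `κ₁`, killed by `κ₂`)
so that also `κ₁ τ′ = κ₁ γ₂`. [cite: Washington1997, §13.1] [cite: NeukirchANT1999, Ch. II §9 Prop. (9.6)] -/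
theorem exists_decomposition_inv_right_v :
    ∃ (δ : absoluteGaloisGroup (v.adicCompletion K)) (h : absoluteGaloisGroup K),
      h ∈ ZpExtension.pairKer κ₁ κ₂ ∧ γ₂⁻¹ = absGaloisRestrict K (v.adicCompletion K) δ * h := by
  obtain ⟨τ, hτ, hκ₂τ⟩ := LinePin.exists_mem_decomp_vbar_apply_eq_of_discr hK hdisc hvbar hv hne.symm κ₂ hκ₂ hpair.right
  obtain ⟨τ', hτ', h1, h2⟩ := exists_mem_decomp_apply_eq_and κ₁ κ₂ hτ hκ₂τ
    (DoublyAdaptedPair.exists_mem_inertia_apply_eq_of_isUnramifiedOutside' hK h2K hκ₁)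
    ((ZpExtension.isUnramifiedOutside_iff κ₂ vbar).mp hκ₂ v hne.symm)
  exact exists_decomposition_of_mem_decomp κ₁ κ₂ hτ' h1 h2

include hK h2K hdisc hv hvbar hne hpair hκ₂ hκ₁ in
/-- **At `v̄`: `γ₁⁻¹ = res_v̄(δ)·h` with `h ∈ Gal(K̄/K̃_∞)`** (`v̄` undecomposed in the `κ₁`-line, corrected by `I_v̄`).
[cite: Washington1997, §13.1] [cite: NeukirchANT1999, Ch. II §9 Prop. (9.6)] -/
theorem exists_decomposition_inv_left_vbar :
    ∃ (δ : absoluteGaloisGroup (vbar.adicCompletion K)) (h : absoluteGaloisGroup K),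
      h ∈ ZpExtension.pairKer κ₁ κ₂ ∧ γ₁⁻¹ = absGaloisRestrict K (vbar.adicCompletion K) δ * h := by
  obtain ⟨τ, hτ, hκ₁τ⟩ := LinePin.exists_mem_decomp_vbar_apply_eq_of_discr hK hdisc hv hvbar hne κ₁ hκ₁ hpair.left
  obtain ⟨τ', hτ', h2, h1⟩ := exists_mem_decomp_apply_eq_and κ₂ κ₁ hτ hκ₁τ
    (DoublyAdaptedPair.exists_mem_inertia_apply_eq_of_isUnramifiedOutside' hK h2K hκ₂)
    ((ZpExtension.isUnramifiedOutside_iff κ₁ v).mp hκ₁ vbar hne)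
  exact exists_decomposition_of_mem_decomp κ₁ κ₂ hτ' h1 h2

end DA7

/-! ## §3 `hplaces` on the `D = −7` frame -/

section HPlaces

variable {K : Type} [Field K] [NumberField K] {κ₁ κ₂ : ZpExtension K 2}
  (θ : FramedGaloisRep K (padicCoeffIntegers (∅ : Set (PadicAlgCl 2))) 1) (hθ2 : ∀ σ : absoluteGaloisGroup K, θ σ ^ 2 = 1)
  {𝔣 : Ideal (𝓞 K)} (hμ : ∀ k : ℕ, ramificationSubgroup K (suppPF 2 𝔣) ≤ ContinuousRep.ker (muTwist 2 (unitChar θ) k))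

include hθ2 hμ in
/-- The uniform conjugation law at a place `w` for a decomposition element `δ`: `u := θ′(res_w δ) = ±1` and
`4·(conj_δ c − u·c) = 0` on every `H²(Λ_n^{(w)}, (μ_{2^k} ⊗ θ′)^{N_S}|)` (`RowOneLocalLaw.four_smul_conjMap_sub_eq_zero_of_apply_eq_{one,neg_one}`).
[cite: JohnsonLeungKings2011, §5.4 Lemma 5.8 (proof)] [cite: SerreLocalFields1979, XIII §3 Prop. 7] -/
theorem exists_forall_four_smul_conjMap_sub_eq_zero (w : HeightOneSpectrum (𝓞 K)) (δ : absoluteGaloisGroup (w.adicCompletion K)) :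
    ∃ u : ℤ, ∀ (n k : ℕ) (c : continuousCohomology 2 (subgroupRep
        (TopRep.res (locHom (S := suppPF 2 𝔣) w : absoluteGaloisGroup (w.adicCompletion K) →* GaloisGroupUnramifiedOutside K (suppPF 2 𝔣))
          ((muTwist 2 (unitChar θ) k).quotientInvariants (ramificationSubgroup K (suppPF 2 𝔣))).toTopRep)
        (((pairLayerSubgroup κ₁ κ₂ n).map (toUnramifiedQuot K (suppPF 2 𝔣))).comap
          (locHom (S := suppPF 2 𝔣) w : absoluteGaloisGroup (w.adicCompletion K) →* GaloisGroupUnramifiedOutside K (suppPF 2 𝔣))))),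
      2 ^ 2 • ((conjMap (TopRep.res (locHom (S := suppPF 2 𝔣) w : absoluteGaloisGroup (w.adicCompletion K) →*
          GaloisGroupUnramifiedOutside K (suppPF 2 𝔣)) ((muTwist 2 (unitChar θ) k).quotientInvariants (ramificationSubgroup K (suppPF 2 𝔣))).toTopRep)
        (((pairLayerSubgroup κ₁ κ₂ n).map (toUnramifiedQuot K (suppPF 2 𝔣))).comap
          (locHom (S := suppPF 2 𝔣) w : absoluteGaloisGroup (w.adicCompletion K) →* GaloisGroupUnramifiedOutside K (suppPF 2 𝔣))) δ 2).hom c -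
        u • c) = 0 := by
  have hdich : ∀ σ : absoluteGaloisGroup K, unitChar θ σ = 1 ∨ unitChar θ σ = -1 := fun σ =>
    unitChar_eq_one_or_eq_neg_one_of_sq hθ2 σ
  rcases hdich (absGaloisRestrict K (w.adicCompletion K) δ) with hδ | hδ
  · refine ⟨1, fun n k c => ?_⟩
    haveI : IsClosed ((((pairLayerSubgroup κ₁ κ₂ n).map (toUnramifiedQuot K (suppPF 2 𝔣))).comap
        (locHom (S := suppPF 2 𝔣) w : absoluteGaloisGroup (w.adicCompletion K) →* GaloisGroupUnramifiedOutside K (suppPF 2 𝔣)) :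
          Subgroup (absoluteGaloisGroup (w.adicCompletion K))) : Set (absoluteGaloisGroup (w.adicCompletion K))) :=
      Subgroup.isClosed_of_isOpen _ (isOpen_localLayer κ₁ κ₂ (suppPF 2 𝔣) w n)
    haveI : Finite (absoluteGaloisGroup (w.adicCompletion K) ⧸ (((pairLayerSubgroup κ₁ κ₂ n).map (toUnramifiedQuot K (suppPF 2 𝔣))).comap
        (locHom (S := suppPF 2 𝔣) w : absoluteGaloisGroup (w.adicCompletion K) →* GaloisGroupUnramifiedOutside K (suppPF 2 𝔣)))) :=
      Subgroup.quotient_finite_of_isOpen _ (isOpen_localLayer κ₁ κ₂ (suppPF 2 𝔣) w n)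
    letI : Fintype (absoluteGaloisGroup (w.adicCompletion K) ⧸ (((pairLayerSubgroup κ₁ κ₂ n).map (toUnramifiedQuot K (suppPF 2 𝔣))).comap
        (locHom (S := suppPF 2 𝔣) w : absoluteGaloisGroup (w.adicCompletion K) →* GaloisGroupUnramifiedOutside K (suppPF 2 𝔣)))) :=
      Fintype.ofFinite _
    exact RowOneLocalLaw.four_smul_conjMap_sub_eq_zero_of_apply_eq_one 2 (unitChar θ) (suppPF 2 𝔣) k w _ (hμ k)
      (fun s _ => hdich _) δ hδ c
  · refine ⟨-1, fun n k c => ?_⟩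
    haveI : IsClosed ((((pairLayerSubgroup κ₁ κ₂ n).map (toUnramifiedQuot K (suppPF 2 𝔣))).comap
        (locHom (S := suppPF 2 𝔣) w : absoluteGaloisGroup (w.adicCompletion K) →* GaloisGroupUnramifiedOutside K (suppPF 2 𝔣)) :
          Subgroup (absoluteGaloisGroup (w.adicCompletion K))) : Set (absoluteGaloisGroup (w.adicCompletion K))) :=
      Subgroup.isClosed_of_isOpen _ (isOpen_localLayer κ₁ κ₂ (suppPF 2 𝔣) w n)
    haveI : Finite (absoluteGaloisGroup (w.adicCompletion K) ⧸ (((pairLayerSubgroup κ₁ κ₂ n).map (toUnramifiedQuot K (suppPF 2 𝔣))).comap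
        (locHom (S := suppPF 2 𝔣) w : absoluteGaloisGroup (w.adicCompletion K) →* GaloisGroupUnramifiedOutside K (suppPF 2 𝔣)))) :=
      Subgroup.quotient_finite_of_isOpen _ (isOpen_localLayer κ₁ κ₂ (suppPF 2 𝔣) w n)
    letI : Fintype (absoluteGaloisGroup (w.adicCompletion K) ⧸ (((pairLayerSubgroup κ₁ κ₂ n).map (toUnramifiedQuot K (suppPF 2 𝔣))).comap
        (locHom (S := suppPF 2 𝔣) w : absoluteGaloisGroup (w.adicCompletion K) →* GaloisGroupUnramifiedOutside K (suppPF 2 𝔣)))) :=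
      Fintype.ofFinite _
    exact RowOneLocalLaw.four_smul_conjMap_sub_eq_zero_of_apply_eq_neg_one 2 (unitChar θ) (suppPF 2 𝔣) k w _ (hμ k)
      (fun s _ => hdich _) δ hδ c

include hθ2 hμ in
/-- The kill at a place `w` containing, in every local layer group, an element `i₀ ∈ Γ_{K_w}` with `res_w i₀ ∈ Gal(K̄/K̃_∞)` and
`θ′(res_w i₀) = −1` (a tame place of the conductor): `4·c = 0` on every `H²(Λ_n^{(w)}, (μ_{2^k} ⊗ θ′)^{N_S}|)`
(`RowOneLocalLaw.four_smul_eq_zero_of_exists_apply_eq_neg_one`). [cite: JohnsonLeungKings2011, §5.4 Lemma 5.8 (proof)] -/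
theorem forall_four_smul_eq_zero_of_apply_eq_neg_one (w : HeightOneSpectrum (𝓞 K)) {i₀ : absoluteGaloisGroup (w.adicCompletion K)}
    (hi₀H : absGaloisRestrict K (w.adicCompletion K) i₀ ∈ ZpExtension.pairKer κ₁ κ₂)
    (hi₀ : unitChar θ (absGaloisRestrict K (w.adicCompletion K) i₀) = -1) :
    ∀ (n k : ℕ) (c : continuousCohomology 2 (subgroupRep
        (TopRep.res (locHom (S := suppPF 2 𝔣) w : absoluteGaloisGroup (w.adicCompletion K) →* GaloisGroupUnramifiedOutside K (suppPF 2 𝔣))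
          ((muTwist 2 (unitChar θ) k).quotientInvariants (ramificationSubgroup K (suppPF 2 𝔣))).toTopRep)
        (((pairLayerSubgroup κ₁ κ₂ n).map (toUnramifiedQuot K (suppPF 2 𝔣))).comap
          (locHom (S := suppPF 2 𝔣) w : absoluteGaloisGroup (w.adicCompletion K) →* GaloisGroupUnramifiedOutside K (suppPF 2 𝔣))))),
      2 ^ 2 • c = 0 := by
  have hdich : ∀ σ : absoluteGaloisGroup K, unitChar θ σ = 1 ∨ unitChar θ σ = -1 := fun σ =>
    unitChar_eq_one_or_eq_neg_one_of_sq hθ2 σ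
  intro n k c
  haveI : IsClosed ((((pairLayerSubgroup κ₁ κ₂ n).map (toUnramifiedQuot K (suppPF 2 𝔣))).comap
      (locHom (S := suppPF 2 𝔣) w : absoluteGaloisGroup (w.adicCompletion K) →* GaloisGroupUnramifiedOutside K (suppPF 2 𝔣)) :
        Subgroup (absoluteGaloisGroup (w.adicCompletion K))) : Set (absoluteGaloisGroup (w.adicCompletion K))) :=
    Subgroup.isClosed_of_isOpen _ (isOpen_localLayer κ₁ κ₂ (suppPF 2 𝔣) w n)
  haveI : Finite (absoluteGaloisGroup (w.adicCompletion K) ⧸ (((pairLayerSubgroup κ₁ κ₂ n).map (toUnramifiedQuot K (suppPF 2 𝔣))).comap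
      (locHom (S := suppPF 2 𝔣) w : absoluteGaloisGroup (w.adicCompletion K) →* GaloisGroupUnramifiedOutside K (suppPF 2 𝔣)))) :=
    Subgroup.quotient_finite_of_isOpen _ (isOpen_localLayer κ₁ κ₂ (suppPF 2 𝔣) w n)
  letI : Fintype (absoluteGaloisGroup (w.adicCompletion K) ⧸ (((pairLayerSubgroup κ₁ κ₂ n).map (toUnramifiedQuot K (suppPF 2 𝔣))).comap
      (locHom (S := suppPF 2 𝔣) w : absoluteGaloisGroup (w.adicCompletion K) →* GaloisGroupUnramifiedOutside K (suppPF 2 𝔣)))) :=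
    Fintype.ofFinite _
  exact RowOneLocalLaw.four_smul_eq_zero_of_exists_apply_eq_neg_one 2 (unitChar θ) (suppPF 2 𝔣) k w _ (hμ k)
    (fun s _ => hdich _) ⟨i₀, mem_localLayer_of_apply_mem κ₁ κ₂ (suppPF 2 𝔣) w n (pairKer_le_pairLayerSubgroup κ₁ κ₂ n hi₀H), hi₀⟩ c

include hθ2 hμ in
/-- The second disjunct of `hplaces` at a place `w` where BOTH pins decompose. [cite: JohnsonLeungKings2011, §5.4 Lemma 5.8 (proof)] -/
theorem hplaces_inr_of_decompositions (w : HeightOneSpectrum (𝓞 K)) {η₁ η₂ : absoluteGaloisGroup K}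
    (hη₁ : ∃ (δ : absoluteGaloisGroup (w.adicCompletion K)) (h : absoluteGaloisGroup K),
      h ∈ ZpExtension.pairKer κ₁ κ₂ ∧ η₁ = absGaloisRestrict K (w.adicCompletion K) δ * h)
    (hη₂ : ∃ (δ : absoluteGaloisGroup (w.adicCompletion K)) (h : absoluteGaloisGroup K),
      h ∈ ZpExtension.pairKer κ₁ κ₂ ∧ η₂ = absGaloisRestrict K (w.adicCompletion K) δ * h) :
    (∃ (δ : absoluteGaloisGroup (w.adicCompletion K)) (h : absoluteGaloisGroup K) (u : ℤ),
        h ∈ ZpExtension.pairKer κ₁ κ₂ ∧ η₁ = absGaloisRestrict K (w.adicCompletion K) δ * h ∧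
        ∀ (n k : ℕ) (c : continuousCohomology 2 (subgroupRep
          (TopRep.res (locHom (S := suppPF 2 𝔣) w : absoluteGaloisGroup (w.adicCompletion K) →* GaloisGroupUnramifiedOutside K (suppPF 2 𝔣))
            ((muTwist 2 (unitChar θ) k).quotientInvariants (ramificationSubgroup K (suppPF 2 𝔣))).toTopRep)
          (((pairLayerSubgroup κ₁ κ₂ n).map (toUnramifiedQuot K (suppPF 2 𝔣))).comap
            (locHom (S := suppPF 2 𝔣) w : absoluteGaloisGroup (w.adicCompletion K) →* GaloisGroupUnramifiedOutside K (suppPF 2 𝔣))))),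
          2 ^ 2 • ((conjMap (TopRep.res (locHom (S := suppPF 2 𝔣) w : absoluteGaloisGroup (w.adicCompletion K) →*
              GaloisGroupUnramifiedOutside K (suppPF 2 𝔣)) ((muTwist 2 (unitChar θ) k).quotientInvariants (ramificationSubgroup K (suppPF 2 𝔣))).toTopRep)
            (((pairLayerSubgroup κ₁ κ₂ n).map (toUnramifiedQuot K (suppPF 2 𝔣))).comap
              (locHom (S := suppPF 2 𝔣) w : absoluteGaloisGroup (w.adicCompletion K) →* GaloisGroupUnramifiedOutside K (suppPF 2 𝔣))) δ 2).hom c -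
            u • c) = 0) ∧
      (∃ (δ : absoluteGaloisGroup (w.adicCompletion K)) (h : absoluteGaloisGroup K) (u : ℤ),
        h ∈ ZpExtension.pairKer κ₁ κ₂ ∧ η₂ = absGaloisRestrict K (w.adicCompletion K) δ * h ∧
        ∀ (n k : ℕ) (c : continuousCohomology 2 (subgroupRep
          (TopRep.res (locHom (S := suppPF 2 𝔣) w : absoluteGaloisGroup (w.adicCompletion K) →* GaloisGroupUnramifiedOutside K (suppPF 2 𝔣))
            ((muTwist 2 (unitChar θ) k).quotientInvariants (ramificationSubgroup K (suppPF 2 𝔣))).toTopRep)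
          (((pairLayerSubgroup κ₁ κ₂ n).map (toUnramifiedQuot K (suppPF 2 𝔣))).comap
            (locHom (S := suppPF 2 𝔣) w : absoluteGaloisGroup (w.adicCompletion K) →* GaloisGroupUnramifiedOutside K (suppPF 2 𝔣))))),
          2 ^ 2 • ((conjMap (TopRep.res (locHom (S := suppPF 2 𝔣) w : absoluteGaloisGroup (w.adicCompletion K) →*
              GaloisGroupUnramifiedOutside K (suppPF 2 𝔣)) ((muTwist 2 (unitChar θ) k).quotientInvariants (ramificationSubgroup K (suppPF 2 𝔣))).toTopRep)
            (((pairLayerSubgroup κ₁ κ₂ n).map (toUnramifiedQuot K (suppPF 2 𝔣))).comap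
              (locHom (S := suppPF 2 𝔣) w : absoluteGaloisGroup (w.adicCompletion K) →* GaloisGroupUnramifiedOutside K (suppPF 2 𝔣))) δ 2).hom c -
            u • c) = 0) := by
  constructor
  · exact hη₁.elim fun δ hδ => hδ.elim fun h hh =>
      (exists_forall_four_smul_conjMap_sub_eq_zero θ hθ2 hμ w δ).elim fun u hu => ⟨δ, h, u, hh.1, hh.2, hu⟩
  · exact hη₂.elim fun δ hδ => hδ.elim fun h hh =>
      (exists_forall_four_smul_conjMap_sub_eq_zero θ hθ2 hμ w δ).elim fun u hu => ⟨δ, h, u, hh.1, hh.2, hu⟩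

include hθ2 hμ in
/-- **THE DISPLAYED LOCAL HYPOTHESIS `hplaces` OF `JLKDescent.classGroupRow_hfcoker`, DISCHARGED ON THE `D = −7` FRAME** (`p = 2`,
`θ′ = unitChar θ`, pins `(γ₁⁻¹, γ₂⁻¹)`, `e = 2`).  For `K` imaginary quadratic with `d_K = −7` and odd class number, `2 = v v̄`, a doubly adapted
pair `(κ₁, κ₂)` with topological generators `γ₁ ∈ I_v`, `γ₂ ∈ I_v̄`, a quadratic `θ`, and a modulus `𝔣` whose support above `2` is `{v, v̄}`
(`h2`), with `N_S ≤ ker(μ_{2^k} ⊗ θ′)` (`hμ`) and an inertia element of sign `−1` inside `Gal(K̄/K̃_∞)` at every tame place of `S = supp(2𝔣)`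
(`hram`): at every `w ∈ S`, EITHER `4` kills every `H²(Λ_n^{(w)}, (μ_{2^k} ⊗ θ′)^{N_S}|)` (tame `w`), OR both pins decompose at `w` and
`4·(conj_{δ_i} c − u_i·c) = 0`, `u_i = θ′(res δ_i) = ±1` (`w = v, v̄`). [cite: JohnsonLeungKings2011, §5.4 Lemma 5.8 (proof)] [cite: SerreLocalFields1979, XIII §3 Prop. 7] -/
theorem hplaces_of_discr_eq_neg_seven (hK : IsImaginaryQuadratic K) (h2K : ¬ 2 ∣ NumberField.classNumber K)
    (hdisc : NumberField.discr K = -7) {v vbar : HeightOneSpectrum (𝓞 K)} (hv : ((2 : ℕ) : 𝓞 K) ∈ v.asIdeal)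
    (hvbar : ((2 : ℕ) : 𝓞 K) ∈ vbar.asIdeal) (hne : vbar ≠ v) {γ₁ γ₂ : absoluteGaloisGroup K}
    (hpair : ZpExtension.IsTopGeneratorPair κ₁ κ₂ γ₁ γ₂) (hκ₂ : κ₂.IsUnramifiedOutside vbar) (hκ₁ : κ₁.IsUnramifiedOutside v)
    (hγ₁ : γ₁ ∈ inertia v) (hγ₂ : γ₂ ∈ inertia vbar)
    (h2 : ∀ w ∈ suppPF 2 𝔣, ((2 : ℕ) : 𝓞 K) ∈ w.asIdeal → w = v ∨ w = vbar)
    (hram : ∀ w ∈ suppPF 2 𝔣, ((2 : ℕ) : 𝓞 K) ∉ w.asIdeal → ∃ i₀ ∈ absInertia (w.adicCompletion K),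
      absGaloisRestrict K (w.adicCompletion K) i₀ ∈ ZpExtension.pairKer κ₁ κ₂ ∧ unitChar θ (absGaloisRestrict K (w.adicCompletion K) i₀) = -1) :
    ∀ w ∈ suppPF 2 𝔣,
      (∀ (n k : ℕ) (c : continuousCohomology 2 (subgroupRep
        (TopRep.res (locHom (S := suppPF 2 𝔣) w : absoluteGaloisGroup (w.adicCompletion K) →* GaloisGroupUnramifiedOutside K (suppPF 2 𝔣))
          ((muTwist 2 (unitChar θ) k).quotientInvariants (ramificationSubgroup K (suppPF 2 𝔣))).toTopRep)
        (((pairLayerSubgroup κ₁ κ₂ n).map (toUnramifiedQuot K (suppPF 2 𝔣))).comap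
          (locHom (S := suppPF 2 𝔣) w : absoluteGaloisGroup (w.adicCompletion K) →* GaloisGroupUnramifiedOutside K (suppPF 2 𝔣))))),
        2 ^ 2 • c = 0) ∨
      ((∃ (δ : absoluteGaloisGroup (w.adicCompletion K)) (h : absoluteGaloisGroup K) (u : ℤ),
          h ∈ ZpExtension.pairKer κ₁ κ₂ ∧ γ₁⁻¹ = absGaloisRestrict K (w.adicCompletion K) δ * h ∧
          ∀ (n k : ℕ) (c : continuousCohomology 2 (subgroupRep
            (TopRep.res (locHom (S := suppPF 2 𝔣) w : absoluteGaloisGroup (w.adicCompletion K) →* GaloisGroupUnramifiedOutside K (suppPF 2 𝔣))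
              ((muTwist 2 (unitChar θ) k).quotientInvariants (ramificationSubgroup K (suppPF 2 𝔣))).toTopRep)
            (((pairLayerSubgroup κ₁ κ₂ n).map (toUnramifiedQuot K (suppPF 2 𝔣))).comap
              (locHom (S := suppPF 2 𝔣) w : absoluteGaloisGroup (w.adicCompletion K) →* GaloisGroupUnramifiedOutside K (suppPF 2 𝔣))))),
            2 ^ 2 • ((conjMap (TopRep.res (locHom (S := suppPF 2 𝔣) w : absoluteGaloisGroup (w.adicCompletion K) →*
                GaloisGroupUnramifiedOutside K (suppPF 2 𝔣)) ((muTwist 2 (unitChar θ) k).quotientInvariants (ramificationSubgroup K (suppPF 2 𝔣))).toTopRep)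
              (((pairLayerSubgroup κ₁ κ₂ n).map (toUnramifiedQuot K (suppPF 2 𝔣))).comap
                (locHom (S := suppPF 2 𝔣) w : absoluteGaloisGroup (w.adicCompletion K) →* GaloisGroupUnramifiedOutside K (suppPF 2 𝔣))) δ 2).hom c -
              u • c) = 0) ∧
        (∃ (δ : absoluteGaloisGroup (w.adicCompletion K)) (h : absoluteGaloisGroup K) (u : ℤ),
          h ∈ ZpExtension.pairKer κ₁ κ₂ ∧ γ₂⁻¹ = absGaloisRestrict K (w.adicCompletion K) δ * h ∧
          ∀ (n k : ℕ) (c : continuousCohomology 2 (subgroupRep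
            (TopRep.res (locHom (S := suppPF 2 𝔣) w : absoluteGaloisGroup (w.adicCompletion K) →* GaloisGroupUnramifiedOutside K (suppPF 2 𝔣))
              ((muTwist 2 (unitChar θ) k).quotientInvariants (ramificationSubgroup K (suppPF 2 𝔣))).toTopRep)
            (((pairLayerSubgroup κ₁ κ₂ n).map (toUnramifiedQuot K (suppPF 2 𝔣))).comap
              (locHom (S := suppPF 2 𝔣) w : absoluteGaloisGroup (w.adicCompletion K) →* GaloisGroupUnramifiedOutside K (suppPF 2 𝔣))))),
            2 ^ 2 • ((conjMap (TopRep.res (locHom (S := suppPF 2 𝔣) w : absoluteGaloisGroup (w.adicCompletion K) →*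
                GaloisGroupUnramifiedOutside K (suppPF 2 𝔣)) ((muTwist 2 (unitChar θ) k).quotientInvariants (ramificationSubgroup K (suppPF 2 𝔣))).toTopRep)
              (((pairLayerSubgroup κ₁ κ₂ n).map (toUnramifiedQuot K (suppPF 2 𝔣))).comap
                (locHom (S := suppPF 2 𝔣) w : absoluteGaloisGroup (w.adicCompletion K) →* GaloisGroupUnramifiedOutside K (suppPF 2 𝔣))) δ 2).hom c -
              u • c) = 0)) := by
  intro w hw
  by_cases h2w : ((2 : ℕ) : 𝓞 K) ∈ w.asIdeal
  · -- `w = v` or `w = v̄`: both pins decompose, second disjunct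
    refine Or.inr ?_
    rcases h2 w hw h2w with hwv | hwv
    · subst hwv
      exact hplaces_inr_of_decompositions θ hθ2 hμ w (exists_decomposition_inv_left_v (κ₁ := κ₁) (κ₂ := κ₂) hγ₁)
        (exists_decomposition_inv_right_v hK h2K hdisc hv hvbar hne hpair hκ₂ hκ₁)
    · subst hwv
      exact hplaces_inr_of_decompositions θ hθ2 hμ w (exists_decomposition_inv_left_vbar hK h2K hdisc hv hvbar hne hpair hκ₂ hκ₁)
        (exists_decomposition_inv_right_vbar (κ₁ := κ₁) (κ₂ := κ₂) hγ₂)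
  · -- tame `w`: an inertia element of sign `−1` lies in every local layer group, first disjunct
    refine Or.inl ?_
    exact (hram w hw h2w).elim fun i₀ hi₀ =>
      forall_four_smul_eq_zero_of_apply_eq_neg_one θ hθ2 hμ w hi₀.2.1 hi₀.2.2

end HPlaces

end Summit.BirchSwinnertonDyer.BirchSwinnertonDyer.Theorems.PrintCf2.JLKDescent

end
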